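import Literature.Probability.RandomPlanarGeometry.SAWScalingLimitFamily
import Mathlib.NumberTheory.Real.Irrational
import HarnessLib

/-!
# Stub `stub_interleave` of line `registered` (crux `LimitExists`, stmt-CriticalPhenomena-1371)

Crux `Summit.CriticalPhenomena.SAWScalingLimit.Theses.SAWRestrictionRigidity.LimitExists` (the
critical `δℤ²` self-avoiding walk has a FULL scaling limit as a chordal curve family), line
`registered` (`Cruxes/LimitExists/Lines/birth.lean`): Billingsley's subsequence principle along
`𝓝[>] 0`.  Uniqueness of subsequential limits compares lattice avoidance probabilities
`g δ (a δ) (b δ)` along two endpoint approximations `(a, b)`, `(a', b')` of the same Dobrushin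
domain `D`; this file is the INTERLEAVING step `(I)`: if the full-filter limit of a mesh
functional `g δ (a δ) (b δ)` exists along `δ → 0⁺` for EVERY endpoint approximation, then that
limit does not depend on the approximation.

Proof (pure filter topology).  Pick a set of meshes `S ⊆ ℝ` such that both `S` and `Sᶜ`
accumulate at `0⁺` (`exists_interleavingSet`: the irrationals, by density of `ℚ` and of
`ℝ ∖ ℚ`).  The interleaved families `S.piecewise a a'`, `S.piecewise b b'` are again an endpoint
approximation (`isEndpointApprox_piecewise`: `IsEndpointApprox` is an eventual reachability
statement plus two limits, all closed under `Set.piecewise` by `Filter.Tendsto.piecewise`), so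
the hypothesis gives a limit `c''` of `g` along it; restricted to the proper filters
`𝓝[>] 0 ⊓ 𝓟 S` and `𝓝[>] 0 ⊓ 𝓟 Sᶜ` the interleaved functional agrees with the one of `(a, b)`,
resp. `(a', b')`, whence `c = c'' = c'` by uniqueness of limits in the Hausdorff space `ℝ≥0∞`.
No named fact is used; axioms are the standard three.
-/

noncomputable section

open Filter Topology Set
open Literature.Probability.RandomPlanarGeometry Literature.Probability.LatticeModels

namespace Summit.CriticalPhenomena.SAWScalingLimit.Theorems.SAWRestrictionRigidityLimitExists

/-- **An interleaving set of meshes**: a set `S ⊆ ℝ` such that both `S` and its complement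
accumulate at `0` from the right, i.e. both restricted filters `𝓝[>] 0 ⊓ 𝓟 S` and
`𝓝[>] 0 ⊓ 𝓟 Sᶜ` are proper.  (Take the irrationals: every interval `(0, ε)` contains an
irrational and a rational number.) [folklore] -/
theorem exists_interleavingSet :
    ∃ S : Set ℝ, (𝓝[>] (0 : ℝ) ⊓ 𝓟 S).NeBot ∧ (𝓝[>] (0 : ℝ) ⊓ 𝓟 Sᶜ).NeBot := by
  refine ⟨{x | Irrational x}, ?_, ?_⟩
  · rw [(nhdsGT_basis (0 : ℝ)).inf_principal_neBot_iff]
    intro ε hε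
    obtain ⟨r, hr, h0r, hrε⟩ := exists_irrational_btwn hε
    exact ⟨r, ⟨h0r, hrε⟩, hr⟩
  · rw [(nhdsGT_basis (0 : ℝ)).inf_principal_neBot_iff]
    intro ε hε
    obtain ⟨q, h0q, hqε⟩ := exists_rat_btwn hε
    exact ⟨q, ⟨h0q, hqε⟩, fun h => q.not_irrational h⟩

/-- **Endpoint approximations are closed under interleaving.**  If `(a, b)` and `(a', b')` are
endpoint approximations of the Dobrushin domain `D` along `δ → 0⁺`, then so is the family that
uses `(a δ, b δ)` for meshes `δ ∈ S` and `(a' δ, b' δ)` for `δ ∉ S`: eventual reachability is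
checked mesh by mesh, and the two mesh-point limits glue by `Filter.Tendsto.piecewise`.
[folklore] -/
theorem isEndpointApprox_piecewise {D : DobrushinDomain} {a b a' b' : ℝ → Site 2} (S : Set ℝ)
    [∀ x, Decidable (x ∈ S)] (h : SAW.IsEndpointApprox D a b)
    (h' : SAW.IsEndpointApprox D a' b') :
    SAW.IsEndpointApprox D (S.piecewise a a') (S.piecewise b b') where
  reachable := by
    filter_upwards [h.reachable, h'.reachable] with δ hδ hδ'
    by_cases hS : δ ∈ S
    · rw [piecewise_eq_of_mem _ _ _ hS, piecewise_eq_of_mem _ _ _ hS]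
      exact hδ
    · rw [piecewise_eq_of_notMem _ _ _ hS, piecewise_eq_of_notMem _ _ _ hS]
      exact hδ'
  tendsto_fst := by
    rw [← S.piecewise_op a a' meshPoint]
    exact (h.tendsto_fst.mono_left inf_le_left).piecewise (h'.tendsto_fst.mono_left inf_le_left)
  tendsto_snd := by
    rw [← S.piecewise_op b b' meshPoint]
    exact (h.tendsto_snd.mono_left inf_le_left).piecewise (h'.tendsto_snd.mono_left inf_le_left)

/-- **Limits along an interleaved approximation are seen by each strand.**  If a mesh functional
of the interleaved endpoints `(S.piecewise a a', S.piecewise b b')` tends to `c''` along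
`𝓝[>] 0`, and the functional of the strand `(a, b)` tends to `c` along `𝓝[>] 0`, then `c = c''`
as soon as `S` accumulates at `0⁺` (the two functionals agree on `S`; limits along the proper
filter `𝓝[>] 0 ⊓ 𝓟 S` are unique in the Hausdorff space `ℝ≥0∞`). [folklore] -/
theorem eq_of_tendsto_piecewise {g : ℝ → Site 2 → Site 2 → ENNReal} {a b a' b' : ℝ → Site 2}
    {S : Set ℝ} [∀ x, Decidable (x ∈ S)] (hS : (𝓝[>] (0 : ℝ) ⊓ 𝓟 S).NeBot) {c c'' : ENNReal}
    (hc : Tendsto (fun δ => g δ (a δ) (b δ)) (𝓝[>] (0 : ℝ)) (𝓝 c))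
    (hc'' : Tendsto (fun δ => g δ (S.piecewise a a' δ) (S.piecewise b b' δ)) (𝓝[>] (0 : ℝ))
      (𝓝 c'')) : c = c'' := by
  haveI := hS
  refine tendsto_nhds_unique (l := 𝓝[>] (0 : ℝ) ⊓ 𝓟 S) (hc.mono_left inf_le_left)
    ((hc''.mono_left inf_le_left).congr' ?_)
  exact eventually_inf_principal.2 (Eventually.of_forall fun δ hδ => by
    simp only [piecewise_eq_of_mem _ _ _ hδ])

/-- **Registered stub `stub_interleave` (I) — full-filter limits of mesh functionals of the
endpoints are approximation-free.**  Let `D` be a Dobrushin domain and `g δ x y ∈ ℝ≥0∞` any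
functional of a mesh and two lattice points such that, for EVERY endpoint approximation `(a, b)`
of `D`, `g δ (a δ) (b δ)` has a limit along `δ → 0⁺`.  Then for two endpoint approximations
`(a, b)`, `(a', b')` with limits `c`, `c'` one has `c = c'`: interleave them on a set of meshes
`S` with `S` and `Sᶜ` both accumulating at `0⁺` (`exists_interleavingSet`,
`isEndpointApprox_piecewise`); the limit `c''` along the interleaved approximation equals `c`
(strand `S`) and `c'` (strand `Sᶜ`) by `eq_of_tendsto_piecewise`. [folklore] -/
theorem stub_interleave : ∀ (D : Literature.Probability.RandomPlanarGeometry.DobrushinDomain) (g : ℝ → Literature.Probability.LatticeModels.Site 2 → Literature.Probability.LatticeModels.Site 2 → ENNReal), (∀ a b : ℝ → Literature.Probability.LatticeModels.Site 2, Literature.Probability.RandomPlanarGeometry.SAW.IsEndpointApprox D a b → ∃ c : ENNReal, Filter.Tendsto (fun δ => g δ (a δ) (b δ)) (nhdsWithin 0 (Set.Ioi 0)) (nhds c)) → ∀ (a b a' b' : ℝ → Literature.Probability.LatticeModels.Site 2) (c c' : ENNReal), Literature.Probability.RandomPlanarGeometry.SAW.IsEndpointApprox D a b → Literature.Probability.RandomPlanarGeometry.SAW.IsEndpointApprox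 D a' b' → Filter.Tendsto (fun δ => g δ (a δ) (b δ)) (nhdsWithin 0 (Set.Ioi 0)) (nhds c) → Filter.Tendsto (fun δ => g δ (a' δ) (b' δ)) (nhdsWithin 0 (Set.Ioi 0)) (nhds c') → c = c' := by
  intro D g hg a b a' b' c c' hab hab' hc hc'
  classical
  obtain ⟨S, hS, hS'⟩ := exists_interleavingSet
  obtain ⟨c'', hc''⟩ := hg _ _ (isEndpointApprox_piecewise S hab hab')
  have h₁ : c = c'' := eq_of_tendsto_piecewise hS hc hc''
  have h₂ : c' = c'' := by
    refine eq_of_tendsto_piecewise (S := Sᶜ) (a' := a) (b' := b) hS' hc' ?_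
    simpa only [Set.piecewise_compl] using hc''
  exact h₁.trans h₂.symm

end Summit.CriticalPhenomena.SAWScalingLimit.Theorems.SAWRestrictionRigidityLimitExists

end
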